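import Summits.CriticalPhenomena.PercolationContinuityZ3.Theorems.Transplant.FKConnectivityAllQForestTreeLevelTools
import Summits.CriticalPhenomena.PercolationContinuityZ3.Theorems.Transplant.FKConnectivityAllQForestAdjacentTwoSum
import Summits.CriticalPhenomena.PercolationContinuityZ3.Theorems.Transplant.FKConnectivityAllQForestSeparatorExchange
import HarnessLib

/-!
# A TIGHT SET CONTAINING `e, f` DECOUPLES: the node on the inside fibre (tree level) gives the node on the whole fibre

Support file (`--supports stmt-CriticalPhenomena-4575`), FK sub-lane `prim-bschramm-fk-1` (generation 29) of the post-continuity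
programme; builds on p205010 (kernel theorem, internal audit signed; external expert review pending).  No definitions, no named facts,
no sorries; standard axioms.  Companion of `…ForestFarTightDecoupling` (tight set NOT containing `e, f`) and `…ForestTreeLevel*`.

SETTING.  Fibre `(M, u)` on `V`; finite vertex set `U`; `E₁ = {g | every vertex of g lies in U}`; `U` TIGHT: `2|U| ≤ |M ∩ E₁| + 2|u ∩ E₁| + 2`,
so both classes of every valid colouring restrict to spanning trees of `U` (`reachable_of_tight` on the inside fibre), and by the
separator-exchange theorem `isForestCfg_union_exchange` (g20) the outside only sees "`U` joined".  For events `P, Q` that only look at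
pairs INSIDE `U`:
* **`fibreCount_eq_mul_of_tightInside`**: `#_{(M,u)}(Fo ∩ P, Fo ∩ Q) = #_{(M ∩ E₁, u ∩ E₁)}(Fo ∩ P, Fo ∩ Q) · #_{(M ∖ E₁, u ∖ E₁)}({ω | ω ∪ T ∈ Fo}, {ζ | ζ ∪ T ∈ Fo})`
  for any forest `T ⊆ E₁` joining `U` pairwise (the outside count does not depend on the inside pair);
* **`adjForestNoSq_fibre_of_tightInside`**: if `e = ov`, `f = oy` lie inside `U` (`o, v, y ∈ U`), the node's inequality on the INSIDE fibre
  `(M ∩ E₁, u ∩ E₁)` implies it on `(M, u)` — and the inside fibre is tight on `U`, so part `…ForestTreeLevel` (`adjForestNoSq_fibre_of_tight`)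
  discharges the hypothesis: **(♣)⁰ holds at `(o; e, f)` in EVERY multigraph in which `o, v, y` lie in a vertex set spanning at least `2|U| − 2`
  pairs** (e.g. inside a `K₄`, a wheel, `K_{3,3}` plus an edge, any rigidity circuit) — case (i) of memo bschramm/FROM-fk-1-g18-VERTEX-NC.md §4c,
  a new infinite unconditional class once the tree level lands.
[cite: CibulkaHladkyLaCroixWagner2008, Thm. 1 (p. 2)] [cite: SempleWelsh2008, Conj. 1.1 (p. 2)] [cite: Linusson2011, Prop. 2.6] [cite: Grimmett2006, §1.5 (p. 13)]
-/

noncomputable section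

namespace Summit.CriticalPhenomena.PercolationContinuityZ3.Theorems
namespace FK

open MeasureTheory Set Literature.Probability.LatticeModels Literature.Probability.Percolation
open scoped Classical symmDiff

variable {V : Type*} [Fintype V]

section TightInside

variable {M u T : BondConfig V} {U : Finset V} {P Q : Set (BondConfig V)}

/-- **A tight set decouples (events inside).**  Let `E₁` be the pairs inside the finite vertex set `U`, tight in the fibre `(M, u)`
(`2|U| ≤ |M ∩ E₁| + 2|u ∩ E₁| + 2`), let `T ⊆ E₁` be a forest joining `U` pairwise, and let `P, Q` be events blind to the pairs OUTSIDE `U`.  Then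
`#_{(M,u)}(Fo ∩ P, Fo ∩ Q) = #_{(M ∩ E₁, u ∩ E₁)}(Fo ∩ P, Fo ∩ Q) · #_{(M ∖ E₁, u ∖ E₁)}({ω | ω ∪ T ∈ Fo}, {ζ | ζ ∪ T ∈ Fo})`.
[cite: CibulkaHladkyLaCroixWagner2008, Thm. 1 (p. 2)] [cite: Linusson2011, Prop. 2.6] [cite: Grimmett2006, §1.5 (p. 13)] -/
theorem fibreCount_eq_mul_of_tightInside (ht : 2 * U.card ≤ (M ∩ {g : Sym2 V | ∀ w ∈ g, w ∈ U}).ncard + 2 * (u ∩ {g : Sym2 V | ∀ w ∈ g, w ∈ U}).ncard + 2)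
    (hT : IsForestCfg T) (hTE : ∀ g ∈ T, ∀ w ∈ g, w ∈ U) (hTU : ∀ x ∈ U, ∀ y ∈ U, (openGraph T).Reachable x y)
    (hP : ∀ ω ω' : BondConfig V, ω ∩ {g : Sym2 V | ∀ w ∈ g, w ∈ U} = ω' ∩ {g : Sym2 V | ∀ w ∈ g, w ∈ U} → (ω ∈ P ↔ ω' ∈ P))
    (hQ : ∀ ω ω' : BondConfig V, ω ∩ {g : Sym2 V | ∀ w ∈ g, w ∈ U} = ω' ∩ {g : Sym2 V | ∀ w ∈ g, w ∈ U} → (ω ∈ Q ↔ ω' ∈ Q)) :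
    fibreCount M u (forestEv V ∩ P) (forestEv V ∩ Q) =
      fibreCount (M ∩ {g : Sym2 V | ∀ w ∈ g, w ∈ U}) (u ∩ {g : Sym2 V | ∀ w ∈ g, w ∈ U}) (forestEv V ∩ P) (forestEv V ∩ Q) *
        fibreCount (M \ {g : Sym2 V | ∀ w ∈ g, w ∈ U}) (u \ {g : Sym2 V | ∀ w ∈ g, w ∈ U})
          {ω | ω ∪ T ∈ forestEv V} {ζ | ζ ∪ T ∈ forestEv V} := by
  set E₁ : Set (Sym2 V) := {g : Sym2 V | ∀ w ∈ g, w ∈ U} with hE₁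
  have hd : Disjoint E₁ E₁ᶜ := disjoint_compl_right
  have hMu : M ∪ u ⊆ E₁ ∪ E₁ᶜ := by rw [union_compl_self]; exact subset_univ _
  have hM2 : M \ E₁ = M ∩ E₁ᶜ := sdiff_eq _ _
  have hu2 : u \ E₁ = u ∩ E₁ᶜ := sdiff_eq _ _
  rw [fibreCount_eq_sum_twoSep hd hMu, hM2, hu2]
  -- inside pairs lie inside `U`; the inside fibre is tight on `U`
  have hS1 : ∀ g ∈ M ∩ E₁ ∪ u ∩ E₁, ∀ w ∈ g, w ∈ U := fun g hg w hw => by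
    rcases hg with hg | hg
    · exact hg.2 w hw
    · exact hg.2 w hw
  have hTE₁ : T ⊆ E₁ := fun g hg w hw => hTE g hg w hw
  -- the inner count: `C` on valid inside configurations, `0` otherwise
  set C := fibreCount (M ∩ E₁ᶜ) (u ∩ E₁ᶜ) {ω | ω ∪ T ∈ forestEv V} {ζ | ζ ∪ T ∈ forestEv V} with hC
  have inner : ∀ ω₁ : BondConfig V, ω₁ \ (M ∩ E₁) = u ∩ E₁ →
      fibreCount (M ∩ E₁ᶜ) (u ∩ E₁ᶜ) {ω₂ | ω₁ ∪ ω₂ ∈ forestEv V ∩ P} {ζ | (ω₁ ∆ (M ∩ E₁)) ∪ ζ ∈ forestEv V ∩ Q} =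
        if ω₁ ∈ forestEv V ∩ P ∧ ω₁ ∆ (M ∩ E₁) ∈ forestEv V ∩ Q then C else 0 := by
    intro ω₁ hω₁
    have hω₁E : ω₁ ⊆ E₁ := fun x hx => ((subset_union_of_fibre hω₁).1 hx).elim (fun h => h.2) (fun h => h.2)
    have hω₁'E : ω₁ ∆ (M ∩ E₁) ⊆ E₁ := fun x hx => ((subset_union_of_fibre hω₁).2 hx).elim (fun h => h.2) (fun h => h.2)
    -- the events only see the inside pair
    have pP : ∀ ω₂ : BondConfig V, ω₂ ⊆ E₁ᶜ → (ω₁ ∪ ω₂ ∈ P ↔ ω₁ ∈ P) := fun ω₂ hω₂ =>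
      hP _ _ (by rw [union_inter_distrib_right, (Set.disjoint_left.2 fun x hx hx' => hω₂ hx hx' : Disjoint ω₂ E₁).inter_eq, union_empty])
    have pQ : ∀ ζ : BondConfig V, ζ ⊆ E₁ᶜ → ((ω₁ ∆ (M ∩ E₁)) ∪ ζ ∈ Q ↔ ω₁ ∆ (M ∩ E₁) ∈ Q) := fun ζ hζ =>
      hQ _ _ (by rw [union_inter_distrib_right, (Set.disjoint_left.2 fun x hx hx' => hζ hx hx' : Disjoint ζ E₁).inter_eq, union_empty])
    split_ifs with hval
    · -- valid inside pair: both classes are spanning trees of `U`; exchange them for `T`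
      obtain ⟨⟨hF₁, hP₁⟩, hF₁', hQ₁⟩ := hval
      have hR₁ : ∀ x ∈ (↑U : Set V), ∀ y ∈ (↑U : Set V), (openGraph ω₁).Reachable x y ↔ (openGraph T).Reachable x y :=
        fun x hx y hy => ⟨fun _ => hTU x hx y hy, fun _ => reachable_of_tight hS1 ht hω₁ hF₁ hF₁' hx hy⟩
      have hR₁' : ∀ x ∈ (↑U : Set V), ∀ y ∈ (↑U : Set V), (openGraph (ω₁ ∆ (M ∩ E₁))).Reachable x y ↔ (openGraph T).Reachable x y :=
        fun x hx y hy => ⟨fun _ => hTU x hx y hy, fun _ => reachable_symmDiff_of_tight hS1 ht hω₁ hF₁ hF₁' hx hy⟩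
      rw [hC]
      refine fibreCount_congr_fibre _ _ fun ω₂ hω₂ => ?_
      have hω₂E : ω₂ ⊆ E₁ᶜ := fun x hx => ((subset_union_of_fibre hω₂).1 hx).elim (fun h => h.2) (fun h => h.2)
      have hζE : ω₂ ∆ (M ∩ E₁ᶜ) ⊆ E₁ᶜ := fun x hx => ((subset_union_of_fibre hω₂).2 hx).elim (fun h => h.2) (fun h => h.2)
      -- exchange lemma, both directions, for the configuration and for its partner
      have ex : ∀ {Z : BondConfig V} {ξ : BondConfig V}, Z ⊆ E₁ → ξ ⊆ E₁ᶜ → IsForestCfg Z →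
          (∀ x ∈ (↑U : Set V), ∀ y ∈ (↑U : Set V), (openGraph Z).Reachable x y ↔ (openGraph T).Reachable x y) →
          (IsForestCfg (Z ∪ ξ) ↔ IsForestCfg (ξ ∪ T)) := by
        intro Z ξ hZ hξ hZF hR
        have hZW : ∀ g ∈ Z, ∀ x ∈ g, x ∈ (univ : Set V) → x ∈ (↑U : Set V) := fun g hg x hx _ => hZ hg x hx
        have hTW : ∀ g ∈ T, ∀ x ∈ g, x ∈ (univ : Set V) → x ∈ (↑U : Set V) := fun g hg x hx _ => hTE g hg x hx
        have hξX : ∀ g ∈ ξ, ∀ x ∈ g, x ∈ (univ : Set V) := fun _ _ _ _ => mem_univ _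
        have hdZ : Disjoint ξ Z := Set.disjoint_left.2 fun x hx hx' => hξ hx (hZ hx')
        have hdT : Disjoint ξ T := Set.disjoint_left.2 fun x hx hx' => hξ hx (hTE₁ hx')
        constructor
        · intro h
          rw [union_comm] at h
          exact isForestCfg_union_exchange hξX hZW hTW hR hdZ hdT h hT
        · intro h
          have h' := isForestCfg_union_exchange hξX hTW hZW (fun x hx y hy => (hR x hx y hy).symm) hdT hdZ h hZF
          rwa [union_comm] at h'
      have e1 : IsForestCfg (ω₁ ∪ ω₂) ↔ IsForestCfg (ω₂ ∪ T) := ex hω₁E hω₂E hF₁ hR₁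
      have e2 : IsForestCfg ((ω₁ ∆ (M ∩ E₁)) ∪ (ω₂ ∆ (M ∩ E₁ᶜ))) ↔ IsForestCfg ((ω₂ ∆ (M ∩ E₁ᶜ)) ∪ T) := ex hω₁'E hζE hF₁' hR₁'
      simp only [mem_setOf_eq, mem_inter_iff, forestEv, e1, e2, pP ω₂ hω₂E, pQ _ hζE, hP₁, hQ₁, and_true]
    · -- inside pair invalid or outside the events: no outside completion
      refine fibreCount_eq_zero_of_forall _ _ _ _ fun ω₂ hω₂ hA hB => hval ⟨⟨?_, ?_⟩, ?_, ?_⟩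
      · exact isForestCfg_of_subset hA.1 subset_union_left
      · exact (pP ω₂ fun x hx => ((subset_union_of_fibre hω₂).1 hx).elim (fun h => h.2) (fun h => h.2)).1 hA.2
      · exact isForestCfg_of_subset hB.1 subset_union_left
      · exact (pQ _ fun x hx => ((subset_union_of_fibre hω₂).2 hx).elim (fun h => h.2) (fun h => h.2)).1 hB.2
  rw [Finset.sum_congr rfl fun ω₁ hω₁ => inner ω₁ (Finset.mem_filter.1 hω₁).2, Finset.sum_ite, Finset.sum_const_zero, add_zero,
    Finset.sum_const, smul_eq_mul, Finset.filter_filter]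
  congr 1
  symm
  exact fibreCount_eq_card_of_iff _ _ _ _ _ fun ω => by simp only [Finset.mem_filter, Finset.mem_univ, true_and]


/-- **The node inside a tight set.**  With `E₁` the pairs inside the tight set `U` (`2|U| ≤ |M ∩ E₁| + 2|u ∩ E₁| + 2`) and `e = ov`, `f = oy`
inside `U` (`o, v, y ∈ U`): the node's inequality on the inside fibre `(M ∩ E₁, u ∩ E₁)` (a tight fibre: the tree level) implies it on `(M, u)`.
[cite: SempleWelsh2008, Conj. 1.1 (p. 2)] [cite: CibulkaHladkyLaCroixWagner2008, Thm. 1 (p. 2)] [cite: Linusson2011, Prop. 2.6] -/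
theorem adjForestNoSq_fibre_of_tightInside {o v y : V}
    (ht : 2 * U.card ≤ (M ∩ {g : Sym2 V | ∀ w ∈ g, w ∈ U}).ncard + 2 * (u ∩ {g : Sym2 V | ∀ w ∈ g, w ∈ U}).ncard + 2)
    (ho : o ∈ U) (hv : v ∈ U) (hy : y ∈ U)
    (hnode : fibreCount (M ∩ {g : Sym2 V | ∀ w ∈ g, w ∈ U}) (u ∩ {g : Sym2 V | ∀ w ∈ g, w ∈ U})
        (forestEv V ∩ {ω | s(o, v) ∈ ω ∧ s(o, y) ∈ ω}) (forestEv V) ≤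
      fibreCount (M ∩ {g : Sym2 V | ∀ w ∈ g, w ∈ U}) (u ∩ {g : Sym2 V | ∀ w ∈ g, w ∈ U})
        (forestEv V ∩ {ω | s(o, v) ∈ ω}) (forestEv V ∩ {ω | s(o, y) ∈ ω})) :
    fibreCount M u (forestEv V ∩ {ω | s(o, v) ∈ ω ∧ s(o, y) ∈ ω}) (forestEv V) ≤
      fibreCount M u (forestEv V ∩ {ω | s(o, v) ∈ ω}) (forestEv V ∩ {ω | s(o, y) ∈ ω}) := by
  set E₁ : Set (Sym2 V) := {g : Sym2 V | ∀ w ∈ g, w ∈ U} with hE₁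
  have heE : s(o, v) ∈ E₁ := fun w hw => by rcases Sym2.mem_iff.1 hw with rfl | rfl <;> assumption
  have hfE : s(o, y) ∈ E₁ := fun w hw => by rcases Sym2.mem_iff.1 hw with rfl | rfl <;> assumption
  have hS1 : ∀ g ∈ M ∩ E₁ ∪ u ∩ E₁, ∀ w ∈ g, w ∈ U := fun g hg w hw => by
    rcases hg with hg | hg
    · exact hg.2 w hw
    · exact hg.2 w hw
  -- blindness of the node's events to outside pairs
  have blind : ∀ (g : Sym2 V), g ∈ E₁ → ∀ ω ω' : BondConfig V, ω ∩ E₁ = ω' ∩ E₁ → (g ∈ ω ↔ g ∈ ω') := fun g hg ω ω' h =>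
    ⟨fun h' => by have : g ∈ ω ∩ E₁ := ⟨h', hg⟩; rw [h] at this; exact this.1,
      fun h' => by have : g ∈ ω' ∩ E₁ := ⟨h', hg⟩; rw [← h] at this; exact this.1⟩
  have hPb : ∀ ω ω' : BondConfig V, ω ∩ E₁ = ω' ∩ E₁ →
      (ω ∈ {ω : BondConfig V | s(o, v) ∈ ω ∧ s(o, y) ∈ ω} ↔ ω' ∈ {ω : BondConfig V | s(o, v) ∈ ω ∧ s(o, y) ∈ ω}) := fun ω ω' h => by
    simp only [mem_setOf_eq, blind _ heE ω ω' h, blind _ hfE ω ω' h]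
  have hPe : ∀ ω ω' : BondConfig V, ω ∩ E₁ = ω' ∩ E₁ → (ω ∈ {ω : BondConfig V | s(o, v) ∈ ω} ↔ ω' ∈ {ω : BondConfig V | s(o, v) ∈ ω}) :=
    fun ω ω' h => by simp only [mem_setOf_eq, blind _ heE ω ω' h]
  have hPf : ∀ ω ω' : BondConfig V, ω ∩ E₁ = ω' ∩ E₁ → (ω ∈ {ω : BondConfig V | s(o, y) ∈ ω} ↔ ω' ∈ {ω : BondConfig V | s(o, y) ∈ ω}) :=
    fun ω ω' h => by simp only [mem_setOf_eq, blind _ hfE ω ω' h]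
  have hU : ∀ ω ω' : BondConfig V, ω ∩ E₁ = ω' ∩ E₁ → (ω ∈ (univ : Set (BondConfig V)) ↔ ω' ∈ (univ : Set (BondConfig V))) :=
    fun _ _ _ => by simp
  by_cases hex : ∃ ω₁ : BondConfig V, ω₁ \ (M ∩ E₁) = u ∩ E₁ ∧ IsForestCfg ω₁ ∧ IsForestCfg (ω₁ ∆ (M ∩ E₁))
  · -- a valid inside pair exists: its first class is a spanning tree `T` of `U`
    obtain ⟨T, hT₁, hT, hT'⟩ := hex
    have hTE : ∀ g ∈ T, ∀ w ∈ g, w ∈ U := fun g hg w hw =>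
      ((subset_union_of_fibre hT₁).1 hg).elim (fun h => h.2 w hw) (fun h => h.2 w hw)
    have hTU : ∀ x ∈ U, ∀ y ∈ U, (openGraph T).Reachable x y := fun x hx y hy => reachable_of_tight hS1 ht hT₁ hT hT' hx hy
    have hb0 : fibreCount M u (forestEv V ∩ {ω | s(o, v) ∈ ω ∧ s(o, y) ∈ ω}) (forestEv V) =
        fibreCount M u (forestEv V ∩ {ω | s(o, v) ∈ ω ∧ s(o, y) ∈ ω}) (forestEv V ∩ univ) := by rw [inter_univ]
    rw [hb0, fibreCount_eq_mul_of_tightInside ht hT hTE hTU hPb hU, fibreCount_eq_mul_of_tightInside ht hT hTE hTU hPe hPf, inter_univ]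
    exact Nat.mul_le_mul_right _ hnode
  · -- no valid inside pair: no valid colouring at all
    rw [fibreCount_eq_zero_of_forall M u _ _ fun ω hω hA hB => hex ⟨ω ∩ E₁, inter_sdiff_inter_of_fibre hω E₁,
      isForestCfg_of_subset hA.1 inter_subset_left, ?_⟩]
    · exact Nat.zero_le _
    · have : (ω ∩ E₁) ∆ (M ∩ E₁) = (ω ∆ M) ∩ E₁ := by
        rw [inter_comm ω, inter_comm M, inter_comm (ω ∆ M), Set.inter_symmDiff_distrib_left]
      rw [this]
      exact isForestCfg_of_subset hB inter_subset_left

end TightInside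

end FK
end Summit.CriticalPhenomena.PercolationContinuityZ3.Theorems

end
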